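import Summits.CriticalPhenomena.CardyFormulaZ2.Theorems.CardyComplexConeEdgePrecompactUFRSCollarDecayRect
import Summits.CriticalPhenomena.CardyFormulaZ2.Theorems.CardyComplexConeEdgePrecompactUFRSStrandsArms

/-!
# Bookkeeping for the single-scale boundary bridge of the UFRS collar decay on rectangles
(line `qkz-strip-boundary-arm` of crux `CardyComplexCone.EdgePrecompact`, stmt-CriticalPhenomena-11387;
first of two files of the registered reduction `ufrs_rectBoundaryStrandDecay_of_bridges`, which
derives the registered bridge `ufrs_rectBoundaryStrandDecay` (BSD, hypothesis of the landed M3 theorem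
`ufrs_screenedCollarDecay_rect_of_boundaryStrandDecay`) from the registered single-scale decays HT
(`ufrs_rect_flatThreeStrandDecay`), HJ (`ufrs_rect_junctionTwoStrandDecay`) and ONE
(`ufrs_rect_oneStrandDecay`); see the module docstring of
`…EdgePrecompactUFRSRectBoundaryStrandDecay.lean` for the whole argument)

Contents (elementary):
* `ufrsStrands_castLE` (registered anchor) — `k` strand-crossings contain `k' ≤ k` strand-crossings;
* `ufrsStrands_eq_empty_of_far`, `ufrsStrands_rect_eq_empty` — no strand family crosses an annulus
  whose outer radius exceeds `(x₁ - x₀) + (y₁ - y₀) + η`: the far end of a strand is the vertex of a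
  corner with an inner face of `E` or of `shiftData E w`, a point of the rectangle or of its translate
  by `E.δ w`, `‖E.δ w‖ < η`;
* `exists_recentre` — a frontier point of an open set is within `ε` of a point of the set at distance
  `≤ ε` from the complement; `medialPoint_mem_junctionFinset`, `exists_markedEdge_of_mem_junctionFinset`
  — the junction set of `exists_junctionFinset` consists exactly of the marked midpoints;
* `rpow_ratio_le`, `rpow_le_mul_rpow` — exponent bookkeeping (`(c x)^θ ≤ c x^γ` for `c x ≤ 1`,
  `γ ≤ min θ 1`; `a ≤ M b ⇒ a^γ ≤ M b^γ`);
* the cases of the one-arm clause of BSD at the shrunken outer radius `R₁ > 2^10 r`, with the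
  bridges read at one datum: `oneArm_near` (a marked midpoint within `32 r`: HJ re-centred at the
  midpoint), `oneArm_far` (no marked midpoint within `R₁`: ONE at an interior point `z'`,
  `dist z z' < r/4`), `inner_oneStrand_le` and `oneArm_mid` (nearest marked midpoint at distance
  `u ≥ R₁/8`: ONE at `(z'; 2r, u/8)`). The product case `u < R₁/8` is in the second file.

References: G. F. Lawler, O. Schramm, W. Werner, Electron. J. Probab. 7 (2002), App. A; H. Kesten,
Comm. Math. Phys. 109 (1987); S. Smirnov, C. R. Acad. Sci. Paris 333 (2001), §2.
-/

set_option linter.unusedVariables false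

namespace Summit.CriticalPhenomena.CardyFormulaZ2.Cruxes.EdgePrecompact.QkzStripBoundaryArm

open MeasureTheory Filter Set Metric
open scoped Topology BigOperators Pointwise
open Literature.Probability.LatticeModels Literature.Probability.Percolation
open Literature.Probability.RandomPlanarGeometry (DobrushinDomain)
open Summit.CriticalPhenomena.CardyFormulaZ2.Theses.CardyComplexCone

noncomputable section

/-! ## Fewer strands, no strands -/

/-- **Fewer strands** (registered anchor `ufrsStrands_castLE` of stmt-CriticalPhenomena-11387). A
family of `k` strand-crossings contains a family of `k' ≤ k` strand-crossings (keep the first `k'`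
witnesses, `Fin.castLE`). -/
theorem ufrsStrands_castLE : ∀ (E : DiscreteDobrushin) (w : Site 2) (z : ℂ) (k k' : ℕ) (r R : ℝ), k' ≤ k → ufrsStrands E w z k r R ⊆ ufrsStrands E w z k' r R := by
  intro E w z k k' r R hk ω hω
  rw [mem_ufrsStrands_iff] at hω ⊢
  obtain ⟨c, i, j, τ, hstr, hdisj⟩ := hω
  exact ⟨fun a => c (Fin.castLE hk a), fun a => i (Fin.castLE hk a), fun a => j (Fin.castLE hk a),
    fun a => τ (Fin.castLE hk a), fun a => hstr (Fin.castLE hk a),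
    fun a b hab => hdisj _ _ fun h => hab (Fin.castLE_injective hk h)⟩

/-- The vertex of a corner whose face is an inner face of the datum `F` is a point of `F.Ω`. -/
theorem meshPoint_mem_of_isInnerFace {F : DiscreteDobrushin} {p : Site 2 × Fin 4}
    (hp : F.IsInnerFace (cFace p)) : meshPoint F.δ p.1 ∈ F.Ω :=
  meshPoint_mem_of_isCorner_of_isInnerFace (isCorner_cFace p) hp

/-- **No strand reaches beyond the two domains.** If every point of `E.Ω` and of the translated
domain `(shiftData E w).Ω` is at distance `< R` from `z`, then no family of `k ≥ 1` strand-crossings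
of `A(z; r, R)` exists: the far end of the first strand is the vertex of a corner with an inner
face of `E` or of `shiftData E w`. -/
theorem ufrsStrands_eq_empty_of_far {E : DiscreteDobrushin} {w : Site 2} {z : ℂ} {k : ℕ} (hk : 1 ≤ k)
    {r R : ℝ} (hE : ∀ p ∈ E.Ω, dist p z < R) (hE' : ∀ p ∈ (shiftData E w).Ω, dist p z < R) :
    ufrsStrands E w z k r R = ∅ := by
  ext ω
  simp only [Set.mem_empty_iff_false, iff_false]
  intro hω
  rw [mem_ufrsStrands_iff] at hω
  obtain ⟨c, i, j, τ, hstr, -⟩ := hω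
  obtain ⟨hij, hends, hinner, -⟩ := hstr ⟨0, hk⟩
  have key : ∀ t, i ⟨0, hk⟩ ≤ t → t ≤ j ⟨0, hk⟩ →
      dist (meshPoint E.δ (cornerOrbit (if τ ⟨0, hk⟩ then E.bcBondConfig ω
        else (shiftData E w).bcBondConfig ω) (c ⟨0, hk⟩) t).1) z < R := by
    intro t h1 h2
    have h := hinner t h1 h2
    cases hτ : τ ⟨0, hk⟩
    · simp only [hτ, Bool.false_eq_true, ↓reduceIte] at h ⊢
      exact hE' _ (meshPoint_mem_of_isInnerFace h)
    · simp only [hτ, ↓reduceIte] at h ⊢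
      exact hE _ (meshPoint_mem_of_isInnerFace h)
  rcases hends with ⟨-, h2⟩ | ⟨h1, -⟩
  · exact absurd h2 (not_le.2 (key _ hij le_rfl))
  · exact absurd h1 (not_le.2 (key _ le_rfl hij))

/-- Two points of an open axis-parallel rectangle are at distance at most the sum of its sides. -/
theorem dist_le_of_mem_rect {x₀ x₁ y₀ y₁ : ℝ} {p q : ℂ} (hp : p ∈ Set.Ioo x₀ x₁ ×ℂ Set.Ioo y₀ y₁)
    (hq : q ∈ Set.Ioo x₀ x₁ ×ℂ Set.Ioo y₀ y₁) : dist p q ≤ (x₁ - x₀) + (y₁ - y₀) := by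
  rw [Complex.mem_reProdIm, Set.mem_Ioo, Set.mem_Ioo] at hp hq
  rw [Complex.dist_eq]
  refine (Complex.norm_le_abs_re_add_abs_im _).trans ?_
  rw [Complex.sub_re, Complex.sub_im]
  have h1 : |p.re - q.re| ≤ x₁ - x₀ := abs_sub_le_iff.2 ⟨by linarith, by linarith⟩
  have h2 : |p.im - q.im| ≤ y₁ - y₀ := abs_sub_le_iff.2 ⟨by linarith, by linarith⟩
  linarith

/-- A point of an open axis-parallel rectangle and a point of its closure are at distance at most
the sum of the sides. -/
theorem dist_le_of_mem_closure_rect {x₀ x₁ y₀ y₁ : ℝ} {p q : ℂ} (hp : p ∈ Set.Ioo x₀ x₁ ×ℂ Set.Ioo y₀ y₁)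
    (hq : q ∈ closure (Set.Ioo x₀ x₁ ×ℂ Set.Ioo y₀ y₁)) : dist p q ≤ (x₁ - x₀) + (y₁ - y₀) := by
  refine le_of_forall_pos_lt_add fun ε hε => ?_
  obtain ⟨q', hq', hqq'⟩ := Metric.mem_closure_iff.1 hq ε hε
  calc dist p q ≤ dist p q' + dist q' q := dist_triangle _ _ _
    _ < (x₁ - x₀) + (y₁ - y₀) + ε := by
        rw [dist_comm q' q]; linarith [dist_le_of_mem_rect hp hq']

/-- **No strands beyond the diameter.** For a datum `E` of the rectangle, a shift with
`‖E.δ w‖ < η`, a centre `z` in the closed rectangle and `R ≥ (x₁ - x₀) + (y₁ - y₀) + η`, the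
strand families across `A(z; r, R)` (`k ≥ 1`) are empty. -/
theorem ufrsStrands_rect_eq_empty {x₀ x₁ y₀ y₁ : ℝ} {E : DiscreteDobrushin}
    (hEΩ : E.Ω = Set.Ioo x₀ x₁ ×ℂ Set.Ioo y₀ y₁) {w : Site 2} {η : ℝ} (hw : ‖meshPoint E.δ w‖ < η)
    {z : ℂ} (hz : z ∈ closure (Set.Ioo x₀ x₁ ×ℂ Set.Ioo y₀ y₁)) {k : ℕ} (hk : 1 ≤ k) {r R : ℝ}
    (hR : (x₁ - x₀) + (y₁ - y₀) + η ≤ R) : ufrsStrands E w z k r R = ∅ := by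
  have h0 : 0 ≤ ‖meshPoint E.δ w‖ := norm_nonneg _
  refine ufrsStrands_eq_empty_of_far hk (fun p hp => ?_) (fun p hp => ?_)
  · rw [hEΩ] at hp
    linarith [dist_le_of_mem_closure_rect hp hz]
  · rw [shiftData_Ω, hEΩ, Set.mem_vadd_set] at hp
    obtain ⟨q, hq, rfl⟩ := hp
    have h1 := dist_le_of_mem_closure_rect hq hz
    calc dist (meshPoint E.δ w +ᵥ q) z ≤ dist (meshPoint E.δ w +ᵥ q) q + dist q z := dist_triangle _ _ _
      _ = ‖meshPoint E.δ w‖ + dist q z := by rw [vadd_eq_add, dist_eq_norm, add_sub_cancel_right]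
      _ < R := by linarith

/-! ## Re-centring at an interior point, marked midpoints -/

/-- **Re-centring.** A frontier point of an open set is within any `ε > 0` of a point of the set
whose distance to the complement is at most `ε`. -/
theorem exists_recentre {D : Set ℂ} (hD : IsOpen D) {z : ℂ} (hz : z ∈ frontier D) {ε : ℝ} (hε : 0 < ε) :
    ∃ z' ∈ D, dist z z' < ε ∧ infDist z' Dᶜ ≤ ε := by
  rw [hD.frontier_eq] at hz
  obtain ⟨z', hz', hzz'⟩ := Metric.mem_closure_iff.1 hz.1 ε hε
  refine ⟨z', hz', hzz', ?_⟩
  calc infDist z' Dᶜ ≤ dist z' z := infDist_le_dist_of_mem hz.2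
    _ ≤ ε := by rw [dist_comm]; exact hzz'.le

/-- The midpoint of every marked edge belongs to the junction set of `exists_junctionFinset`. -/
theorem medialPoint_mem_junctionFinset {E : DiscreteDobrushin} {w : Site 2} {J : Finset ℂ}
    (hJ : ∀ (z : ℂ) (ρ' : ℝ), (z ∈ ufrsMarkedNbhd E w ρ' ↔ ∃ m ∈ J, dist m z ≤ ρ'))
    {e₀ : Sym2 (Site 2)} (he₀ : e₀ ∈ E.zdABEdges ∨ e₀ ∈ (shiftData E w).zdABEdges) :
    medialPoint E.δ e₀ ∈ J := by
  have h : medialPoint E.δ e₀ ∈ ufrsMarkedNbhd E w 0 :=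
    (mem_ufrsMarkedNbhd_iff _ _ _ _).2 ⟨e₀, he₀, by rw [dist_self]⟩
  obtain ⟨m, hm, hd⟩ := (hJ _ _).1 h
  rw [dist_le_zero] at hd
  exact hd ▸ hm

/-- Every point of the junction set is the midpoint of a marked edge. -/
theorem exists_markedEdge_of_mem_junctionFinset {E : DiscreteDobrushin} {w : Site 2} {J : Finset ℂ}
    (hJ : ∀ (z : ℂ) (ρ' : ℝ), (z ∈ ufrsMarkedNbhd E w ρ' ↔ ∃ m ∈ J, dist m z ≤ ρ'))
    {m : ℂ} (hm : m ∈ J) :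
    ∃ e₀ : Sym2 (Site 2), (e₀ ∈ E.zdABEdges ∨ e₀ ∈ (shiftData E w).zdABEdges) ∧ medialPoint E.δ e₀ = m := by
  obtain ⟨e₀, he₀, hd⟩ := (mem_ufrsMarkedNbhd_iff _ _ _ _).1 ((hJ m 0).2 ⟨m, hm, by rw [dist_self]⟩)
  exact ⟨e₀, he₀, dist_le_zero.1 hd⟩

/-! ## Exponent bookkeeping -/

/-- Lowering the exponent of a ratio `c x ≤ 1` to `γ ≤ min θ 1` and taking the constant out. -/
theorem rpow_ratio_le {x c γ θ : ℝ} (hx : 0 ≤ x) (hc : 1 ≤ c) (hcx : c * x ≤ 1) (hγ : 0 < γ)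
    (hγ1 : γ ≤ 1) (hγθ : γ ≤ θ) : (c * x) ^ θ ≤ c * x ^ γ := by
  have h0 : 0 ≤ c * x := by positivity
  calc (c * x) ^ θ ≤ (c * x) ^ γ := Real.rpow_le_rpow_of_exponent_ge' h0 hcx hγ.le hγθ
    _ = c ^ γ * x ^ γ := Real.mul_rpow (by linarith) hx
    _ ≤ c * x ^ γ := mul_le_mul_of_nonneg_right (Real.rpow_le_self_of_one_le hc hγ1) (by positivity)

/-- Comparing two ratios: `a ≤ M b`, `M ≥ 1`, `γ ≤ 1` give `a^γ ≤ M b^γ`. -/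
theorem rpow_le_mul_rpow {a b M γ : ℝ} (ha : 0 ≤ a) (hb : 0 ≤ b) (hM : 1 ≤ M) (hab : a ≤ M * b)
    (hγ : 0 < γ) (hγ1 : γ ≤ 1) : a ^ γ ≤ M * b ^ γ :=
  calc a ^ γ ≤ (M * b) ^ γ := Real.rpow_le_rpow ha hab hγ.le
    _ = M ^ γ * b ^ γ := Real.mul_rpow (by linarith) hb
    _ ≤ M * b ^ γ := mul_le_mul_of_nonneg_right (Real.rpow_le_self_of_one_le hM hγ1) (by positivity)

/-! ## The four cases of the one-arm clause at the shrunken outer radius `R₁` -/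

/-- **Case (A): a marked midpoint within `32 r` of `z`.** Three strands across `A(z; r, R₁)` are two
strands across `A(m; 33 r, R₁ - 32 r)` around the midpoint `m`; the junction two-strand decay (HJ,
read at the datum) bounds them by `66 C_J (r/R₁)^γ` for `γ ≤ min β 1`, `R₁ > 2^10 r`. -/
theorem oneArm_near {E : DiscreteDobrushin} {w : Site 2} {η CJ β γ r R₁ : ℝ} {z : ℂ}
    (hCJ : 0 < CJ) (hγ : 0 < γ) (hγ1 : γ ≤ 1) (hγβ : γ ≤ β)
    (hJloc : ∀ e₀ : Sym2 (Site 2), (e₀ ∈ E.zdABEdges ∨ e₀ ∈ (shiftData E w).zdABEdges) →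
      ∀ s S : ℝ, η ≤ s → 0 < S →
        (bondPercolation (zdGraph 2) half).real (ufrsStrands E w (medialPoint E.δ e₀) 2 s S) ≤ CJ * (s / S) ^ β)
    {e₀ : Sym2 (Site 2)} (he₀ : e₀ ∈ E.zdABEdges ∨ e₀ ∈ (shiftData E w).zdABEdges)
    (hmz : dist (medialPoint E.δ e₀) z ≤ 32 * r) (hηr : 8 * η ≤ r) (hr : 0 < r) (hR₁ : 2 ^ 10 * r < R₁) :
    (bondPercolation (zdGraph 2) half).real (ufrsStrands E w z 3 r R₁) ≤ 66 * CJ * (r / R₁) ^ γ := by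
  have hR₁0 : 0 < R₁ := by linarith
  have hsub : ufrsStrands E w z 3 r R₁ ⊆ ufrsStrands E w (medialPoint E.δ e₀) 2 (33 * r) (R₁ - 32 * r) := by
    refine (ufrsStrands_castLE _ _ _ _ _ _ _ (by norm_num : 2 ≤ 3)).trans (ufrsStrands_mono ?_ ?_)
    · rw [dist_comm]; linarith
    · rw [dist_comm]; linarith
  have hb := hJloc e₀ he₀ (33 * r) (R₁ - 32 * r) (by linarith) (by linarith)
  have hratio : 33 * r / (R₁ - 32 * r) ≤ 66 * (r / R₁) :=
    calc 33 * r / (R₁ - 32 * r) ≤ 33 * r / (R₁ / 2) :=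
          div_le_div_of_nonneg_left (by positivity) (by positivity) (by linarith)
      _ = 66 * (r / R₁) := by field_simp; ring
  have hrR₁ : r / R₁ ≤ 1 / 2 ^ 10 := by
    rw [div_le_div_iff₀ hR₁0 (by positivity)]; linarith
  have h66 : 66 * (r / R₁) ≤ 1 := by linarith
  calc (bondPercolation (zdGraph 2) half).real (ufrsStrands E w z 3 r R₁)
      ≤ (bondPercolation (zdGraph 2) half).real (ufrsStrands E w (medialPoint E.δ e₀) 2 (33 * r) (R₁ - 32 * r)) :=
        measureReal_mono hsub (measure_ne_top _ _)
    _ ≤ CJ * (33 * r / (R₁ - 32 * r)) ^ β := hb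
    _ ≤ CJ * (66 * (r / R₁)) ^ β :=
        mul_le_mul_of_nonneg_left
          (Real.rpow_le_rpow (div_nonneg (by positivity) (by linarith)) hratio (by linarith)) hCJ.le
    _ ≤ CJ * (66 * (r / R₁) ^ γ) :=
        mul_le_mul_of_nonneg_left (rpow_ratio_le (by positivity) (by norm_num) h66 hγ hγ1 hγβ) hCJ.le
    _ = 66 * CJ * (r / R₁) ^ γ := by ring

/-- **Case (B1): no marked midpoint within `R₁` of `z`.** Three strands across `A(z; r, R₁)` are one
strand across `A(z'; 2r, R₁/2 - r)` around the interior point `z'` (`dist z z' < r/4`), where the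
one-strand decay (ONE, read at the datum) applies: bound `8 C₁ (r/R₁)^γ`. -/
theorem oneArm_far {Dc : Set ℂ} {E : DiscreteDobrushin} {w : Site 2} {η C1 α1 γ r R₁ : ℝ} {z z' : ℂ}
    (hC1 : 0 < C1) (hγ : 0 < γ) (hγ1 : γ ≤ 1) (hγ1' : γ ≤ α1)
    (hOloc : ∀ (c : ℂ) (s S : ℝ), c ∈ Dc → infDist c Dcᶜ ≤ s → η ≤ s → 0 < S →
      (∀ e₀ : Sym2 (Site 2), (e₀ ∈ E.zdABEdges ∨ e₀ ∈ (shiftData E w).zdABEdges) →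
        2 * S ≤ dist (medialPoint E.δ e₀) c) →
      (bondPercolation (zdGraph 2) half).real (ufrsStrands E w c 1 s S) ≤ C1 * (s / S) ^ α1)
    (hz'D : z' ∈ Dc) (hz'd : infDist z' Dcᶜ ≤ r / 4) (hzz' : dist z z' < r / 4)
    (hjf : ∀ e₀ : Sym2 (Site 2), (e₀ ∈ E.zdABEdges ∨ e₀ ∈ (shiftData E w).zdABEdges) →
      2 * (R₁ / 2 - r) ≤ dist (medialPoint E.δ e₀) z')
    (hηr : 8 * η ≤ r) (hr : 0 < r) (hR₁ : 2 ^ 10 * r < R₁) :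
    (bondPercolation (zdGraph 2) half).real (ufrsStrands E w z 3 r R₁) ≤ 8 * C1 * (r / R₁) ^ γ := by
  have hR₁0 : 0 < R₁ := by linarith
  have hsub : ufrsStrands E w z 3 r R₁ ⊆ ufrsStrands E w z' 1 (2 * r) (R₁ / 2 - r) :=
    (ufrsStrands_castLE _ _ _ _ _ _ _ (by norm_num : 1 ≤ 3)).trans
      (ufrsStrands_mono (by linarith [hzz'.le]) (by linarith [hzz'.le]))
  have hb := hOloc z' (2 * r) (R₁ / 2 - r) hz'D (by linarith) (by linarith) (by linarith) hjf
  have hratio : 2 * r / (R₁ / 2 - r) ≤ 8 * (r / R₁) :=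
    calc 2 * r / (R₁ / 2 - r) ≤ 2 * r / (R₁ / 4) :=
          div_le_div_of_nonneg_left (by positivity) (by positivity) (by linarith)
      _ = 8 * (r / R₁) := by field_simp; ring
  have hrR₁ : r / R₁ ≤ 1 / 2 ^ 10 := by
    rw [div_le_div_iff₀ hR₁0 (by positivity)]; linarith
  have h8 : 8 * (r / R₁) ≤ 1 := by linarith
  calc (bondPercolation (zdGraph 2) half).real (ufrsStrands E w z 3 r R₁)
      ≤ (bondPercolation (zdGraph 2) half).real (ufrsStrands E w z' 1 (2 * r) (R₁ / 2 - r)) :=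
        measureReal_mono hsub (measure_ne_top _ _)
    _ ≤ C1 * (2 * r / (R₁ / 2 - r)) ^ α1 := hb
    _ ≤ C1 * (8 * (r / R₁)) ^ α1 :=
        mul_le_mul_of_nonneg_left
          (Real.rpow_le_rpow (div_nonneg (by positivity) (by linarith)) hratio (by linarith)) hC1.le
    _ ≤ C1 * (8 * (r / R₁) ^ γ) :=
        mul_le_mul_of_nonneg_left (rpow_ratio_le (by positivity) (by norm_num) h8 hγ hγ1 hγ1') hC1.le
    _ = 8 * C1 * (r / R₁) ^ γ := by ring

/-- **The inner one-strand event of cases (B2).** If every marked midpoint is at distance `≥ u/4`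
from the interior point `z'`, one strand across `A(z'; 2r, u/8)` costs `C₁ · 16 (r/u)^γ`
(`u > 32 r`). -/
theorem inner_oneStrand_le {Dc : Set ℂ} {E : DiscreteDobrushin} {w : Site 2} {η C1 α1 γ r u : ℝ} {z' : ℂ}
    (hC1 : 0 < C1) (hγ : 0 < γ) (hγ1 : γ ≤ 1) (hγ1' : γ ≤ α1)
    (hOloc : ∀ (c : ℂ) (s S : ℝ), c ∈ Dc → infDist c Dcᶜ ≤ s → η ≤ s → 0 < S →
      (∀ e₀ : Sym2 (Site 2), (e₀ ∈ E.zdABEdges ∨ e₀ ∈ (shiftData E w).zdABEdges) →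
        2 * S ≤ dist (medialPoint E.δ e₀) c) →
      (bondPercolation (zdGraph 2) half).real (ufrsStrands E w c 1 s S) ≤ C1 * (s / S) ^ α1)
    (hz'D : z' ∈ Dc) (hz'd : infDist z' Dcᶜ ≤ r / 4)
    (hjf : ∀ e₀ : Sym2 (Site 2), (e₀ ∈ E.zdABEdges ∨ e₀ ∈ (shiftData E w).zdABEdges) →
      2 * (u / 8) ≤ dist (medialPoint E.δ e₀) z')
    (hηr : 8 * η ≤ r) (hr : 0 < r) (hu32 : 32 * r < u) :
    (bondPercolation (zdGraph 2) half).real (ufrsStrands E w z' 1 (2 * r) (u / 8)) ≤ C1 * (16 * (r / u) ^ γ) := by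
  have hu0 : 0 < u := by linarith
  have hb := hOloc z' (2 * r) (u / 8) hz'D (by linarith) (by linarith) (by positivity) hjf
  have hratio : 2 * r / (u / 8) = 16 * (r / u) := by field_simp; ring
  have h16 : 16 * (r / u) ≤ 1 := by
    rw [mul_div_assoc', div_le_one hu0]; linarith
  refine hb.trans ?_
  rw [hratio]
  exact mul_le_mul_of_nonneg_left (rpow_ratio_le (by positivity) (by norm_num) h16 hγ hγ1 hγ1') hC1.le

/-- **Case (B2a): the nearest marked midpoint at distance `u ∈ [R₁/8, R₁)`.** The inner one-strand
event alone gives `128 C₁ (r/R₁)^γ`. -/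
theorem oneArm_mid {Dc : Set ℂ} {E : DiscreteDobrushin} {w : Site 2} {η C1 α1 γ r u R₁ : ℝ} {z z' : ℂ}
    (hC1 : 0 < C1) (hγ : 0 < γ) (hγ1 : γ ≤ 1) (hγ1' : γ ≤ α1)
    (hOloc : ∀ (c : ℂ) (s S : ℝ), c ∈ Dc → infDist c Dcᶜ ≤ s → η ≤ s → 0 < S →
      (∀ e₀ : Sym2 (Site 2), (e₀ ∈ E.zdABEdges ∨ e₀ ∈ (shiftData E w).zdABEdges) →
        2 * S ≤ dist (medialPoint E.δ e₀) c) →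
      (bondPercolation (zdGraph 2) half).real (ufrsStrands E w c 1 s S) ≤ C1 * (s / S) ^ α1)
    (hz'D : z' ∈ Dc) (hz'd : infDist z' Dcᶜ ≤ r / 4) (hzz' : dist z z' < r / 4)
    (hjf : ∀ e₀ : Sym2 (Site 2), (e₀ ∈ E.zdABEdges ∨ e₀ ∈ (shiftData E w).zdABEdges) →
      2 * (u / 8) ≤ dist (medialPoint E.δ e₀) z')
    (hηr : 8 * η ≤ r) (hr : 0 < r) (hu32 : 32 * r < u) (huR : u < R₁) (hu8 : R₁ ≤ 8 * u) :
    (bondPercolation (zdGraph 2) half).real (ufrsStrands E w z 3 r R₁) ≤ 128 * C1 * (r / R₁) ^ γ := by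
  have hu0 : 0 < u := by linarith
  have hR₁0 : 0 < R₁ := by linarith
  have hsub : ufrsStrands E w z 3 r R₁ ⊆ ufrsStrands E w z' 1 (2 * r) (u / 8) :=
    (ufrsStrands_castLE _ _ _ _ _ _ _ (by norm_num : 1 ≤ 3)).trans
      (ufrsStrands_mono (by linarith [hzz'.le]) (by linarith [hzz'.le]))
  have hru : r / u ≤ 8 * (r / R₁) := by
    rw [div_le_iff₀ hu0, show 8 * (r / R₁) * u = r * (8 * u) / R₁ by ring, le_div_iff₀ hR₁0]
    exact mul_le_mul_of_nonneg_left hu8 hr.le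
  have hpow : (r / u) ^ γ ≤ 8 * (r / R₁) ^ γ :=
    rpow_le_mul_rpow (by positivity) (by positivity) (by norm_num) hru hγ hγ1
  calc (bondPercolation (zdGraph 2) half).real (ufrsStrands E w z 3 r R₁)
      ≤ (bondPercolation (zdGraph 2) half).real (ufrsStrands E w z' 1 (2 * r) (u / 8)) :=
        measureReal_mono hsub (measure_ne_top _ _)
    _ ≤ C1 * (16 * (r / u) ^ γ) := inner_oneStrand_le hC1 hγ hγ1 hγ1' hOloc hz'D hz'd hjf hηr hr hu32
    _ ≤ C1 * (16 * (8 * (r / R₁) ^ γ)) :=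
        mul_le_mul_of_nonneg_left (mul_le_mul_of_nonneg_left hpow (by norm_num)) hC1.le
    _ = 128 * C1 * (r / R₁) ^ γ := by ring

end

end Summit.CriticalPhenomena.CardyFormulaZ2.Cruxes.EdgePrecompact.QkzStripBoundaryArm
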